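import Summits.RiemannHypothesis.RiemannHypothesis.Theorems.JensenPolynomialsCapCertCompute

/-!
# Route `JensenPolynomials` — `XiCumulantMajorantCap` kernel packaging: the certificate RUNS of `capCheck` (3 ≤ d ≤ 3000)

RH-FREE, γ-FREE proof-of-data (rung J-P(P1′), cell rh-jensen, engine target ET1 «C2GEN-CERT»).  COMPUTATIONAL part:
six `capCheckRange a n = true` facts covering `3 ≤ d ≤ 3000` by `native_decide` (the evidence class of the route's table
crux packaging), plus two kernel-only spot rows by `decide +kernel` (standard axioms): `d = 1371` (the degree of the global
maximum `S₁ = 0.83125…` of the certified two-evaluator table, kit j250011) and `d = 17` (largest degree with `M_d = 10⁴ + d`).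
This file depends only on the checker (part 1); the soundness parts 2–6 turn these Booleans into the two real
inequalities of item 19217 (`JensenPolynomialsXiCumulantMajorantCapBelow`).  A kernel-only upgrade of the whole range is
≈ 2–3 s of kernel time per degree in chunks of ≤ 50 degrees per theorem.  Nothing here bears on the truth of RH.
-/

-- D-0017: `Summit.RiemannHypothesis.RiemannHypothesis.…` duplicates the namespace BY DESIGN (single-problem summit).
set_option linter.dupNamespace false

namespace Summit.RiemannHypothesis.RiemannHypothesis.Theorems.JensenPolynomials.CapCert

/-- Certificate run (computational): every `3 ≤ d < 503` passes `capCheck`. -/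
theorem capCheckRange_3 : capCheckRange 3 500 = true := by native_decide

/-- Certificate run (computational): every `503 ≤ d < 1003` passes `capCheck`. -/
theorem capCheckRange_503 : capCheckRange 503 500 = true := by native_decide

/-- Certificate run (computational): every `1003 ≤ d < 1503` passes `capCheck`. -/
theorem capCheckRange_1003 : capCheckRange 1003 500 = true := by native_decide

/-- Certificate run (computational): every `1503 ≤ d < 2003` passes `capCheck`. -/
theorem capCheckRange_1503 : capCheckRange 1503 500 = true := by native_decide

/-- Certificate run (computational): every `2003 ≤ d < 2503` passes `capCheck`. -/
theorem capCheckRange_2003 : capCheckRange 2003 500 = true := by native_decide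

/-- Certificate run (computational): every `2503 ≤ d < 3001` passes `capCheck`. -/
theorem capCheckRange_2503 : capCheckRange 2503 498 = true := by native_decide

/-- Kernel-only spot certificate (standard axioms, `decide +kernel`): the degree of the global maximum `d = 1371` passes. -/
theorem capCheck_1371_kernel : capCheck 1371 = true := by
  set_option maxRecDepth 100000 in decide +kernel

/-- Kernel-only spot certificate (standard axioms): `d = 17`, the largest degree with `M_d = 10⁴ + d`, passes. -/
theorem capCheck_17_kernel : capCheck 17 = true := by
  set_option maxRecDepth 100000 in decide +kernel

end Summit.RiemannHypothesis.RiemannHypothesis.Theorems.JensenPolynomials.CapCert
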